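import Mathlib
import Literature.NumberTheory.LFunctions.Zhang2022.SkeletonLemma84Rel
import Literature.NumberTheory.LFunctions.Zhang2022.TypedSection12B
import HarnessLib

/-!
# Zhang (2022), typed skeleton XIX: the §§12–17 evaluations with errors RELATIVE to `𝔞` and the
# §18 assembly re-proved for them; Lemma 12.1 in a tenable form

Topic `Literature/NumberTheory/LFunctions/Zhang2022` (Landau–Siegel audit tree; verdict-neutral).
Y. Zhang, *Discrete mean estimates and the Landau–Siegel zero*, arXiv:2211.02515v1 (2022)
[Zhang2022LandauSiegel] — **an unrefereed manuscript under adjudication; every `def … : Prop`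
below is a CLAIM NODE, STATED NOT ASSERTED** (a named hypothesis of the whole-DAG theorem); the
theorems are kernel-checked bookkeeping between nodes.

Why this file exists (campaign D-0069; TEAM A family adjudication G-L4fam-1 "𝔞 / L′(1,χ) size under
(A)", adj-1 2026-08-26T00:51Z; sz-d35's kernel result `lemma121R_untenable`): (1) the §§15–17 /
Appendix-B computations deliver the evaluations (15.24), (16.17), (17.10) (and, through (12.17) and
(13.11), the whole of (18.1)) with errors of size `o(𝔞𝔓 + 𝔓)`, not the `o(𝔓)` the skeleton types
(`Eval1524/1617/1710/1217/137`, `Eq1311`); every consumer compares at the scale `𝔞𝔓`, and `𝔞 ≫ 1`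
(Lemma 5.7, DISCHARGED: `frakALowerBound_holds`), so the relative errors are structurally harmless —
this file banks the RELATIVE evaluation nodes (`…Rel`, error `ε·(𝔞+1)·𝔓`), proves that the absolute
nodes imply them, re-proves the two assembly edges for them (`eval181Rel_of_parts` = (18.1) from its
five parts; `ineq232_of_evals_rel` = "(8.23), (9.7), (18.1) and the margin give (2.32)") and the
endgame `theorem1_of_evaluations_rel`; (2) the printed third clause of Lemma 12.1 ("`|ε₁ⱼ(d)| < 10⁻⁵`"
pointwise) is untenable under (A) (`Typed.Sec12B.lemma121R_untenable`: it drops a unimodular factor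
`(d/P″₁)^{−β₆}`); the tenable node `Lemma121T c′ := Lemma121Rii c′ ∧ Typed.Sec12B.U020 c′` keeps
clauses (i)–(ii) (α₁-reading) and replaces (iii) by the closed form with that factor (L3-t5's `U020`;
sz-d35: `U020_holds`). The proof nodes of §§12, 15, 16, 17 are re-pointed accordingly (`Ded1217V`,
`Ded1524V`, `Ded1617V`, `Ded1710V`), consuming the relative Lemmas 8.3/8.4 (`Lemma83Rel`,
`Lemma84Rel`), `Lemma121T`, `Lemma151ChiR`, and concluding the RELATIVE evaluations. The whole-DAG
theorem re-threads through them from version `v8`.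

What is NOT asserted: any claim node. Nothing here bears on Theorems 1–2 of the source; the margin
`Margin232` consumed by the assembly is REFUTED in the kernel (`not_margin232`).

## References

* Y. Zhang, arXiv:2211.02515v1 (2022), §12 Lemma 12.1 and (12.17), §13 (13.7), (13.11), §15 (15.24),
  §16 (16.17), §17 (17.10), §18 (18.1) and p. 36 (the deduction of (2.32)), §2 p. 6.
  [cite: Zhang2022LandauSiegel, §18 (18.1)]
-/

noncomputable section

open Complex Real

namespace Literature.NumberTheory.LFunctions.Zhang2022.Skeleton

/-! ## The relative evaluation nodes -/

section Nodes

variable (c' c₀ : ℝ)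

/-- **(12.17), error relative to `𝔞`**: `‖Ξ₁₅ − (e₁* + 2e₂*)𝔞𝔓‖ ≤ 10⁻⁵𝔞𝔓 + ε(𝔞+1)𝔓` eventually,
for every `ε > 0` (the banked `Eval1217` has `ε𝔓`). CLAIM. [cite: Zhang2022LandauSiegel, §12 (12.17)] -/
def Eval1217Rel : Prop :=
  ∀ ε : ℝ, 0 < ε → ForAllLarge fun D _ χ => AssumptionA D χ →
    ‖xi15 c' χ - (e1star + 2 * e2star) * frakA χ * frakP D‖ ≤
      1e-5 * frakA χ * frakP D + ε * (frakA χ + 1) * frakP D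

/-- **(13.11), relative**: `𝔈 ≤ ε(𝔞+1)𝔓` eventually, every `ε > 0` (banked `Eq1311`: `ε𝔓`). CLAIM.
[cite: Zhang2022LandauSiegel, §13 (13.11)] -/
def Eq1311Rel : Prop :=
  ∀ ε : ℝ, 0 < ε → ForAllLarge fun D _ χ => AssumptionA D χ →
    frakE c' c₀ χ ≤ ε * (frakA χ + 1) * frakP D

/-- **(13.7)+(13.11), relative**: `‖Ξ₁₄ + i(Φ₁+Φ₂−Φ₃)‖ ≤ ε(𝔞+1)𝔓` eventually. CLAIM.
[cite: Zhang2022LandauSiegel, §13 (13.7)] -/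
def Eval137Rel : Prop :=
  ∀ ε : ℝ, 0 < ε → ForAllLarge fun D _ χ => AssumptionA D χ →
    ‖xi14 c' χ + I * (Phi1 c' χ + Phi2 c' χ - Phi3 c' χ)‖ ≤ ε * (frakA χ + 1) * frakP D

/-- **(15.24), relative**: `‖Φ₁ − (𝔢₁+2𝔢₂+𝔢₃)𝔞𝔓‖ ≤ ε(𝔞+1)𝔓` eventually. CLAIM.
[cite: Zhang2022LandauSiegel, §15 (15.24)] -/
def Eval1524Rel : Prop :=
  ∀ ε : ℝ, 0 < ε → ForAllLarge fun D _ χ => AssumptionA D χ →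
    ‖Phi1 c' χ - (frake 1 + 2 * frake 2 + frake 3) * frakA χ * frakP D‖ ≤
      ε * (frakA χ + 1) * frakP D

/-- **(16.17), relative**: `‖Φ₂ − (𝔢₁+𝔢₂)𝔞𝔓‖ ≤ ε(𝔞+1)𝔓` eventually. CLAIM.
[cite: Zhang2022LandauSiegel, §16 (16.17)] -/
def Eval1617Rel : Prop :=
  ∀ ε : ℝ, 0 < ε → ForAllLarge fun D _ χ => AssumptionA D χ →
    ‖Phi2 c' χ - (frake 1 + frake 2) * frakA χ * frakP D‖ ≤ ε * (frakA χ + 1) * frakP D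

/-- **(17.10), relative**: `‖Φ₃ + (𝔢₀+𝔢₁)𝔞𝔓‖ ≤ ε(𝔞+1)𝔓` eventually. CLAIM.
[cite: Zhang2022LandauSiegel, §17 (17.10)] -/
def Eval1710Rel : Prop :=
  ∀ ε : ℝ, 0 < ε → ForAllLarge fun D _ χ => AssumptionA D χ →
    ‖Phi3 c' χ + (frake0 + frake 1) * frakA χ * frakP D‖ ≤ ε * (frakA χ + 1) * frakP D

/-- **(18.1), relative**: `‖Ξ₁₃ − 𝔠₃𝔞𝔓‖ ≤ 10⁻⁵𝔞𝔓 + ε(𝔞+1)𝔓` eventually, every `ε > 0`. CLAIM.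
[cite: Zhang2022LandauSiegel, §18 (18.1)] -/
def Eval181Rel : Prop :=
  ∀ ε : ℝ, 0 < ε → ForAllLarge fun D _ χ => AssumptionA D χ →
    ‖xi13 c' χ - frakc3 * frakA χ * frakP D‖ ≤ 1e-5 * frakA χ * frakP D + ε * (frakA χ + 1) * frakP D

/-- **Lemma 12.1, clauses (i)–(ii) only, `α₁ := α log T` reading** (§12 p. 25): the first two
conjuncts of `Lemma121R c′`. CLAIM. [cite: Zhang2022LandauSiegel, §12 Lemma 12.1] -/
def Lemma121Rii : Prop :=
  ∃ c : ℝ, 0 < c ∧ ∃ C : ℝ, ForAllLarge fun D _ χ => AssumptionA D χ →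
    ∀ j ∈ ({1, 2, 3} : Finset ℕ), ∀ d : ℕ, 1 ≤ d →
      let S : ℂ := ∑ l ∈ Finset.Ico 1 ⌈P2pp D⌉₊,
        χ (l : ZMod D) * vk13 D (d * l) / (l : ℂ) ^ (1 - betaJ c' D j)
      ((d : ℝ) ≤ P1pp D / bigT D → ‖S‖ ≤ C * bigT D ^ (-c)) ∧
      (P1pp D / bigT D < d → (d : ℝ) ≤ P1pp D → ‖S‖ ≤ C * alpha1 D)

/-- **Lemma 12.1, tenable form**: clauses (i)–(ii) (`Lemma121Rii`) together with the CLOSED FORM of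
the third range that keeps the unimodular factor `(d/P″₁)^{−β₆}` the print drops — L3-t5's node
`Typed.Sec12B.U020` (the printed pointwise "`|ε₁ⱼ(d)| < 10⁻⁵`" is untenable under (A):
`Typed.Sec12B.lemma121R_untenable`, sz-d35). CLAIM. [cite: Zhang2022LandauSiegel, §12 Lemma 12.1] -/
def Lemma121T : Prop := Lemma121Rii c' ∧ Typed.Sec12B.U020 c'

/-- **§12 ⇒ (12.17), relative inputs and output** (node of record): `Prop71 → Lemma81 → Lemma82 →
Lemma83Rel → Lemma84Rel → Lemma58 → Lemma121T → Lemma123 → Eval1217Rel`. CLAIM.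
[cite: Zhang2022LandauSiegel, §12 (12.6)–(12.17)] -/
def Ded1217V : Prop :=
  Prop71 c' → Lemma81 c' → Lemma82 c' → Lemma83Rel c' → Lemma84Rel c' → Lemma58 → Lemma121T c' →
    Lemma123 c' → Eval1217Rel c'

/-- **§15 ⇒ (15.24), relative output** (node of record): `Prop141 → Lemma55 → Lemma58 →
Lemma151ChiR → Eval1524Rel`. CLAIM. [cite: Zhang2022LandauSiegel, §15 (15.1)–(15.24)] -/
def Ded1524V : Prop := Prop141 → Lemma55 → Lemma58 → Lemma151ChiR c' → Eval1524Rel c'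

/-- **§16 ⇒ (16.17), relative output** (node of record). CLAIM.
[cite: Zhang2022LandauSiegel, §16 (16.1)–(16.17)] -/
def Ded1617V : Prop := Prop141 → Lemma55 → Lemma58 → Lemma151ChiR c' → Eval1617Rel c'

/-- **§17 ⇒ (17.10), relative output** (node of record). CLAIM.
[cite: Zhang2022LandauSiegel, §17 (17.1)–(17.10)] -/
def Ded1710V : Prop := Prop141 → AppBLemma171 → Lemma151ChiR c' → Eval1710Rel c'

end Nodes

/-! ## Absolute nodes imply the relative ones -/

section Edges

variable {c' c₀ : ℝ}

/-- Plumbing: an `ε·P` bound is an `ε·(A+1)·P` bound when `A, P, ε ≥ 0`. [folklore] -/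
private theorem rel_of_abs {ε A P x : ℝ} (hA : 0 ≤ A) (hP : 0 ≤ P) (hε : 0 ≤ ε)
    (h : x ≤ ε * P) : x ≤ ε * (A + 1) * P := by nlinarith [mul_nonneg (mul_nonneg hε hA) hP]

/-- `Eval1217 ⇒ Eval1217Rel`. [cite: Zhang2022LandauSiegel, §12 (12.17)] -/
theorem eval1217Rel_of_eval1217 (h : Eval1217 c') : Eval1217Rel c' := fun ε hε =>
  (h ε hε).mono fun D _ χ _ _ hS hA => by
    have := hS hA
    nlinarith [mul_nonneg (mul_nonneg hε.le (frakA_nonneg χ)) (frakP_nonneg D)]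

/-- `Eq1311 ⇒ Eq1311Rel`. [cite: Zhang2022LandauSiegel, §13 (13.11)] -/
theorem eq1311Rel_of_eq1311 (h : Eq1311 c' c₀) : Eq1311Rel c' c₀ := fun ε hε =>
  (h ε hε).mono fun D _ χ _ _ hS hA =>
    rel_of_abs (frakA_nonneg χ) (frakP_nonneg D) hε.le (hS hA)

/-- `Eval1524 ⇒ Eval1524Rel`. [cite: Zhang2022LandauSiegel, §15 (15.24)] -/
theorem eval1524Rel_of_eval1524 (h : Eval1524 c') : Eval1524Rel c' := fun ε hε =>
  (h ε hε).mono fun D _ χ _ _ hS hA =>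
    rel_of_abs (frakA_nonneg χ) (frakP_nonneg D) hε.le (hS hA)

/-- `Eval1617 ⇒ Eval1617Rel`. [cite: Zhang2022LandauSiegel, §16 (16.17)] -/
theorem eval1617Rel_of_eval1617 (h : Eval1617 c') : Eval1617Rel c' := fun ε hε =>
  (h ε hε).mono fun D _ χ _ _ hS hA =>
    rel_of_abs (frakA_nonneg χ) (frakP_nonneg D) hε.le (hS hA)

/-- `Eval1710 ⇒ Eval1710Rel`. [cite: Zhang2022LandauSiegel, §17 (17.10)] -/
theorem eval1710Rel_of_eval1710 (h : Eval1710 c') : Eval1710Rel c' := fun ε hε =>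
  (h ε hε).mono fun D _ χ _ _ hS hA =>
    rel_of_abs (frakA_nonneg χ) (frakP_nonneg D) hε.le (hS hA)

/-- `Lemma121R ⇒ Lemma121Rii` (drop the third clause). [cite: Zhang2022LandauSiegel, §12 Lemma 12.1] -/
theorem lemma121Rii_of_lemma121R (h : Lemma121R c') : Lemma121Rii c' := by
  obtain ⟨c, hc, C, hC⟩ := h
  exact ⟨c, hc, C, hC.mono fun D _ χ _ _ hS hA j hj d hd => by
    have h3 := hS hA j hj d hd
    exact ⟨h3.1, h3.2.1⟩⟩

/-- **(13.7) + (13.11, relative) ⇒ `Ξ₁₄ = −i(Φ₁+Φ₂−Φ₃) + o((𝔞+1)𝔓)`**.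
[cite: Zhang2022LandauSiegel, §13 (13.7), (13.11)] -/
theorem eval137Rel_of (h137 : Eq137 c' c₀) (h1311 : Eq1311Rel c' c₀) : Eval137Rel c' := by
  intro ε hε
  obtain ⟨C, hC⟩ := h137
  obtain ⟨D₀, h⟩ := hC.and (h1311 (ε / (|C| + 1)) (by positivity))
  refine ⟨D₀, fun D _ χ hD hq hp hA => ?_⟩
  obtain ⟨h1, h2⟩ := h D χ hD hq hp
  have hE0 : 0 ≤ frakE c' c₀ χ := frakE_nonneg c' c₀ χ
  have hAP : 0 ≤ (frakA χ + 1) * frakP D :=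
    mul_nonneg (by linarith [frakA_nonneg χ]) (frakP_nonneg D)
  calc ‖xi14 c' χ + I * (Phi1 c' χ + Phi2 c' χ - Phi3 c' χ)‖ ≤ C * frakE c' c₀ χ := h1 hA
    _ ≤ |C| * frakE c' c₀ χ := by gcongr; exact le_abs_self C
    _ ≤ |C| * (ε / (|C| + 1) * (frakA χ + 1) * frakP D) := by gcongr; exact h2 hA
    _ = (|C| * (ε / (|C| + 1))) * ((frakA χ + 1) * frakP D) := by ring
    _ ≤ ε * ((frakA χ + 1) * frakP D) := by
        gcongr
        rw [mul_div_assoc', div_le_iff₀ (by positivity)]; nlinarith [abs_nonneg C]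
    _ = ε * (frakA χ + 1) * frakP D := by ring

/-- **(18.1), relative, from its five parts** — the exact linear combination of `eval181_of_parts`
with relative errors: `Ξ₁₃ = Ξ₁₄ + Ξ₁₅` and `−i(3𝔢₁+3𝔢₂+𝔢₃+𝔢₀) + e₁* + 2e₂* = 𝔠₃`.
[cite: Zhang2022LandauSiegel, §18 (18.1)] -/
theorem eval181Rel_of_parts (h1217 : Eval1217Rel c') (h137 : Eval137Rel c')
    (h1524 : Eval1524Rel c') (h1617 : Eval1617Rel c') (h1710 : Eval1710Rel c') :
    Eval181Rel c' := by
  intro ε hε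
  have hε5 : 0 < ε / 5 := by positivity
  obtain ⟨D₀, h⟩ := ((((h1217 _ hε5).and (h137 _ hε5)).and (h1524 _ hε5)).and (h1617 _ hε5)).and
    (h1710 _ hε5)
  refine ⟨D₀, fun D _ χ hD hq hp hA => ?_⟩
  obtain ⟨⟨⟨⟨e1217, e137⟩, e1524⟩, e1617⟩, e1710⟩ := h D χ hD hq hp
  have g1217 := e1217 hA
  have g137 := e137 hA
  have g1524 := e1524 hA
  have g1617 := e1617 hA
  have g1710 := e1710 hA
  have key : xi13 c' χ - frakc3 * frakA χ * frakP D =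
      (xi14 c' χ + I * (Phi1 c' χ + Phi2 c' χ - Phi3 c' χ)) +
      (-I) * (Phi1 c' χ - (frake 1 + 2 * frake 2 + frake 3) * frakA χ * frakP D) +
      (-I) * (Phi2 c' χ - (frake 1 + frake 2) * frakA χ * frakP D) +
      I * (Phi3 c' χ + (frake0 + frake 1) * frakA χ * frakP D) +
      (xi15 c' χ - (e1star + 2 * e2star) * frakA χ * frakP D) := by
    rw [xi13_eq_xi14_add_xi15, frakc3]
    ring
  rw [key]
  have nI : ‖(-I : ℂ)‖ = 1 := by simp
  calc ‖(xi14 c' χ + I * (Phi1 c' χ + Phi2 c' χ - Phi3 c' χ)) +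
        (-I) * (Phi1 c' χ - (frake 1 + 2 * frake 2 + frake 3) * frakA χ * frakP D) +
        (-I) * (Phi2 c' χ - (frake 1 + frake 2) * frakA χ * frakP D) +
        I * (Phi3 c' χ + (frake0 + frake 1) * frakA χ * frakP D) +
        (xi15 c' χ - (e1star + 2 * e2star) * frakA χ * frakP D)‖
      ≤ ‖xi14 c' χ + I * (Phi1 c' χ + Phi2 c' χ - Phi3 c' χ)‖ +
        ‖(-I) * (Phi1 c' χ - (frake 1 + 2 * frake 2 + frake 3) * frakA χ * frakP D)‖ +
        ‖(-I) * (Phi2 c' χ - (frake 1 + frake 2) * frakA χ * frakP D)‖ +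
        ‖I * (Phi3 c' χ + (frake0 + frake 1) * frakA χ * frakP D)‖ +
        ‖xi15 c' χ - (e1star + 2 * e2star) * frakA χ * frakP D‖ := by
          refine le_trans (norm_add_le _ _) ?_
          gcongr
          refine le_trans (norm_add_le _ _) ?_
          gcongr
          refine le_trans (norm_add_le _ _) ?_
          gcongr
          exact norm_add_le _ _
    _ ≤ ε / 5 * (frakA χ + 1) * frakP D + ε / 5 * (frakA χ + 1) * frakP D +
        ε / 5 * (frakA χ + 1) * frakP D + ε / 5 * (frakA χ + 1) * frakP D +
        (1e-5 * frakA χ * frakP D + ε / 5 * (frakA χ + 1) * frakP D) := by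
          rw [norm_mul, norm_mul, norm_mul, nI, Complex.norm_I, one_mul, one_mul, one_mul]
          gcongr
    _ = 1e-5 * frakA χ * frakP D + ε * (frakA χ + 1) * frakP D := by ring

/-- **§18 p. 36 with relative errors: "(8.23), (9.7) and (18.1) [relative] yield (2.32)"** — the
`o((𝔞+1)𝔓)` error is absorbed by the margin since `𝔞 ≥ a₀ > 0` (Lemma 5.7): choose
`ε = m·a₀/(8 + 4a₀)` where `m = 0.001 − (𝔠₁ + 𝔠₂ + 2(Re 𝔠₃ + 10⁻⁵))`. Its hypothesis `Margin232` is
REFUTED in the kernel (`not_margin232`). [cite: Zhang2022LandauSiegel, §18 p. 36] -/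
theorem ineq232_of_evals_rel (h22 : Prop22i) (h23 : Lemma23 c') (hprim : PsiChiPrimitive)
    (h823 : Eval823 c') (h97 : Eval97 c') (h181 : Eval181Rel c') (hm : Margin232)
    (ha : FrakALowerBound) : Ineq232 c' := by
  obtain ⟨a₀, ha₀, ha⟩ := ha
  obtain ⟨D₁, hP⟩ := frakP_eventually_pos
  rw [Margin232] at hm
  set m : ℝ := 0.001 - (frakc1.re + frakc2.re + 2 * (frakc3.re + 1e-5)) with hm_def
  have hm0 : 0 < m := by rw [hm_def]; linarith
  set ε : ℝ := m * a₀ / (8 + 4 * a₀) with hε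
  have hε0 : 0 < ε := by positivity
  have hεid : ε * (8 + 4 * a₀) = m * a₀ := by rw [hε]; field_simp
  obtain ⟨D₀, h⟩ := ((((h22.and h23).and (h823 ε hε0)).and (h97 ε hε0)).and (h181 ε hε0)).and ha
  refine ⟨max (max D₀ D₁) 3, fun D _ χ hD hq hp hA => ?_⟩
  have hD3 : 3 ≤ D := le_trans (le_max_right _ _) hD
  have hD₀ : D₀ ≤ D := le_trans (le_trans (le_max_left _ _) (le_max_left _ _)) hD
  have hD₁ : D₁ ≤ D := le_trans (le_trans (le_max_right _ _) (le_max_left _ _)) hD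
  obtain ⟨⟨⟨⟨⟨h22', h23'⟩, h823'⟩, h97'⟩, h181'⟩, ha'⟩ := h D χ hD₀ hq hp
  have hPpos : 0 < frakP D := hP D hD₁
  have haa : a₀ ≤ frakA χ := ha' hA
  have e1 := abs_le.mp (h823' hA)
  have e2 := abs_le.mp (h97' hA)
  have e3 : |(xi13 c' χ).re - frakc3.re * frakA χ * frakP D| ≤
      1e-5 * frakA χ * frakP D + ε * (frakA χ + 1) * frakP D := by
    have h3 := h181' hA
    have : (xi13 c' χ - frakc3 * frakA χ * frakP D).re =
        (xi13 c' χ).re - frakc3.re * frakA χ * frakP D := by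
      simp [Complex.sub_re, Complex.mul_re]
    rw [← this]
    exact le_trans (Complex.abs_re_le_norm _) h3
  have e3' := abs_le.mp e3
  rw [xi1_eq_of χ hD3 h23' h22' (fun x => hprim D χ x hD3 hp)]
  -- `Ξ₁ ≤ (𝔠₁ + 𝔠₂ + 2Re 𝔠₃ + 2·10⁻⁵)𝔞𝔓 + ε(4 + 2𝔞)𝔓` and `ε(4 + 2𝔞) < m𝔞`
  have hA0 : 0 < frakA χ := lt_of_lt_of_le ha₀ haa
  have h4 : ε * (4 + 2 * frakA χ) * frakP D < m * frakA χ * frakP D := by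
    have hlt : ε * (4 + 2 * frakA χ) < m * frakA χ := by
      -- ε(4+2𝔞)(8+4a₀) = m a₀ (4+2𝔞) = m(4a₀ + 2a₀𝔞) < m(8𝔞 + 4a₀𝔞) = m𝔞(8+4a₀)
      have h8 : (0 : ℝ) < 8 + 4 * a₀ := by positivity
      have key : ε * (4 + 2 * frakA χ) * (8 + 4 * a₀) < m * frakA χ * (8 + 4 * a₀) := by
        calc ε * (4 + 2 * frakA χ) * (8 + 4 * a₀) = m * a₀ * (4 + 2 * frakA χ) := by
              rw [mul_assoc, mul_comm (4 + 2 * frakA χ), ← mul_assoc, hεid]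
          _ = m * (4 * a₀ + 2 * a₀ * frakA χ) := by ring
          _ < m * (8 * frakA χ + 4 * a₀ * frakA χ) := by
              refine mul_lt_mul_of_pos_left ?_ hm0
              nlinarith
          _ = m * frakA χ * (8 + 4 * a₀) := by ring
      exact lt_of_mul_lt_mul_right key h8.le
    exact mul_lt_mul_of_pos_right hlt hPpos
  nlinarith [e1.2, e2.2, e3'.2]

/-- **Theorem 1 from the evaluations, with (18.1) in the relative form** (the endgame of
`SkeletonAssembly.theorem1_of_evaluations` re-run with `ineq232_of_evals_rel`).
[cite: Zhang2022LandauSiegel, §2 p. 6, §18] -/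
theorem theorem1_of_evaluations_rel (h22 : Prop22i) (h23 : Lemma23 c')
    (h1017 : Eval1017 c') (h823 : Eval823 c') (h97 : Eval97 c') (h181 : Eval181Rel c')
    (hm : Margin232) (h183 : Bound183 c') (h111 : Eval111 c') : Theorem1 :=
  have ha : FrakALowerBound := frakALowerBound_holds
  have hprim : PsiChiPrimitive := psiChiPrimitive_holds
  theorem1_of_props h22 h23 (prop24_of_eval h1017 Prop24Main_holds ha)
    (prop25_of_ineqs h22 h23 hprim (ineq232_of_evals_rel h22 h23 hprim h823 h97 h181 hm ha)
      (ineq233_of_bound h183 ha))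
    (prop26_of_evals h22 h23 hprim h111 h97 ha)

/-- `Ded1524ChiR ⇒ Ded1524V`. [cite: Zhang2022LandauSiegel, §15 (15.24)] -/
theorem ded1524V_of_R (h : Ded1524ChiR c') : Ded1524V c' :=
  fun h141 h55 h58 h151 => eval1524Rel_of_eval1524 (h h141 h55 h58 h151)

/-- `Ded1617ChiR ⇒ Ded1617V`. [cite: Zhang2022LandauSiegel, §16 (16.17)] -/
theorem ded1617V_of_R (h : Ded1617ChiR c') : Ded1617V c' :=
  fun h141 h55 h58 h151 => eval1617Rel_of_eval1617 (h h141 h55 h58 h151)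

/-- `Ded1710ChiR ⇒ Ded1710V`. [cite: Zhang2022LandauSiegel, §17 (17.10)] -/
theorem ded1710V_of_R (h : Ded1710ChiR c') : Ded1710V c' :=
  fun h141 h171 h151 => eval1710Rel_of_eval1710 (h h141 h171 h151)

end Edges

end Literature.NumberTheory.LFunctions.Zhang2022.Skeleton
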